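import Literature.NumberTheory.EllipticCurves.HeegnerPointsKolyvaginVisibleDescentTelescopeProofs
import Literature.GroupTheory.FiniteAbelian.SymplecticModules
import Literature.GroupTheory.FiniteAbelian.IndependentGenerators
import HarnessLib

/-!
# Kolyvagin's bound `#Ш ≤ p^{2M₀}` (McCallum 1991, §1 Theorem) for VISIBLE split data, any prime `p`

Visible twin of `HeegnerPointsKolyvaginSplitDescentOrderProofs` (the ORDER statement of McCallum's
§1 Theorem — `#(Sel/ℤx) ≤ p^{2M₀}` — for the split data `KolyvaginDescent.SplitHypothesesM`, from the
split telescope and the symplectic structure of the Cassels–Tate pairing). Same statement and proof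
for the VISIBLE data `KolyvaginDescent.VisibleSplitHypothesesM`
(`HeegnerPointsKolyvaginVisibleDescentProofs`: restriction map `rK : V →+ H` to `K(E_{p^M})`,
factorisation of the local condition at Kolyvagin primes, visible Selmer group — the form whose
Čebotarev inputs ARE provable at `p = 2` for the pair `(E, E^D)` over `ℚ`), on top of the visible
telescope `VisibleSplitHypothesesM.sum_expo_le_M₀_of_casselsTate`
(`HeegnerPointsKolyvaginVisibleDescentTelescopeProofs`): `Q = Sel/ℤx` is the DIRECT sum of the
images `Q^{±}` of `Sel ∩ V^{±ε}`, orthogonal for the induced pairing (`hPcross`), each symplectic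
(`exists_lagrangian_sq_eq_card`, Wall 1963 / Tignol–Amitsur), independent generators of the two
Lagrangians lift to PURE classes interleaved as McCallum's `D^{-ε} = D₁ × D₃ × ⋯`,
`D^{ε} = D₂ × D₄ × ⋯`, and the telescope gives `∑ expo ≤ M₀`.

* `VisibleSplitHypothesesM.card_sel_le_of_casselsTate` — **`#Sel ≤ p^M · p^{2M₀}`**;
* `VisibleSplitHypothesesM.card_quotient_le_of_casselsTate` — **`#(Sel/ℤx) ≤ p^{2M₀}`**.

Inputs (displayed hypotheses): the Cassels–Tate pairing pulled back to `Sel` (alternating,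
`hPcross`, vanishing on `x`, non-degenerate modulo `ℤx`); `hCTV` (McCallum Prop. 4.7 + Lemma 5.3 +
Prop. 4.4 in order language); `hCeb` in the VISIBLE kernel form (two rays, for spans on which `rK`
is injective — at `2`: character-form Step B + criterion of the BSD route `GenusKolyvaginAtTwo`);
`hcsupp` (Lemma 4.3 for square-free `n`); the annihilator `hkill` (`E₀ = 2M₀` by the visible
descent, `VisibleSplitHypothesesM.claimA` / `claimB`). Reading at `2` for a VISIBLE pair
(`Sel₂(E^{ε}) ⊕ Sel₂(E^{-ε}) ⊕ 𝔽₂ξ_E` direct): `#Ш(E/ℚ)_{2^M} · #Ш(E^{(d_K)}/ℚ)_{2^M} ≤ 4^{M₀}`.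
No definition, no named fact; nothing here is a claim about BSD.

## References

* W. G. McCallum, *Kolyvagin's work on Shafarevich–Tate groups*, LMS LNS 153 (1991), 295–316:
  §1 Theorem, p. 299, §5 Thm. 5.4 (proof, p. 312), Cor. 5.6. [McCallumLMS1991]
* V. A. Kolyvagin, Izv. 1989, §3; *Euler systems* (1990), Thm. A. [Kolyvagin1989Izv]
* C. T. C. Wall, Topology 2 (1963), Lemma 7; J.-P. Tignol, S. A. Amitsur, J. Algebra 98 (1986),
  Thm. 4.1. [Wall1963QuadraticFormsFiniteGroups]
-/

open scoped Classical

namespace Literature.NumberTheory.EllipticCurves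

namespace KolyvaginDescent

namespace VisibleSplitHypothesesM

open Literature.GroupTheory.FiniteAbelian

section OrderBound

variable {V : Type*} [AddCommGroup V] {Pl : Type*} {H : Type*} [AddCommGroup H]
variable (S : VisibleSplitHypothesesM V Pl H)


/-! ### Plumbing: orders, purity, the quotient `Sel/ℤx` -/

/-- `x` has order exactly `p^M`: `k • x = 0 ↔ p^M ∣ k`. [folklore] -/
private theorem zsmul_x_eq_zero_iff' (k : ℤ) : k • S.x = 0 ↔ ((S.p : ℤ) ^ S.M) ∣ k :=
  zsmul_eq_zero_iff_prime_pow_dvd S.hp (S.torsion S.x) S.x_ord k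

/-- `p^{expo s} • s = 0`. [folklore] -/
private theorem pow_expo_zsmul' (s : V) : ((S.p : ℤ) ^ S.expo s) • s = 0 := by
  have h : ∃ a : ℕ, ((S.p : ℤ) ^ a) • s = 0 := ⟨S.M, S.torsion s⟩
  exact Nat.find_spec h

/-- `p^{expo s - 1} • s ≠ 0` when `expo s ≠ 0`. [folklore] -/
private theorem pow_expo_sub_one_zsmul_ne_zero' {s : V} (h : S.expo s ≠ 0) :
    ((S.p : ℤ) ^ (S.expo s - 1)) • s ≠ 0 := by
  have h' : ∃ a : ℕ, ((S.p : ℤ) ^ a) • s = 0 := ⟨S.M, S.torsion s⟩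
  have hlt : S.expo s - 1 < Nat.find h' := Nat.sub_one_lt h
  exact Nat.find_min h' hlt

/-- `ord s = p^{expo s}`. [folklore] -/
private theorem addOrderOf_eq_pow_expo' (s : V) : addOrderOf s = S.p ^ S.expo s := by
  by_cases h : S.expo s = 0
  · have hs : s = 0 := by
      have := S.pow_expo_zsmul' s
      rwa [h, pow_zero, one_smul] at this
    rw [h, pow_zero, hs, addOrderOf_zero]
  · exact addOrderOf_eq_prime_pow S.hp (S.pow_expo_zsmul' s) (S.pow_expo_sub_one_zsmul_ne_zero' h)

/-- `expo s ≤ a` as soon as `p^a • s = 0`. [folklore] -/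
private theorem expo_le_of_pow_zsmul_eq_zero' {s : V} {a : ℕ} (h : ((S.p : ℤ) ^ a) • s = 0) :
    S.expo s ≤ a := by
  have h' : ∃ a : ℕ, ((S.p : ℤ) ^ a) • s = 0 := ⟨S.M, S.torsion s⟩
  exact Nat.find_min' h' h

/-- `V^{ε} ∩ V^{-ε} = 0`. [folklore] -/
private theorem eq_zero_of_mem_part_both {v : V} (h₁ : v ∈ S.part S.ε) (h₂ : v ∈ S.part (-S.ε)) :
    v = 0 := by
  rcases S.hε with h | h
  · rw [h] at h₁ h₂
    exact S.part_disjoint v h₁ h₂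
  · rw [h] at h₁ h₂
    rw [neg_neg] at h₂
    exact S.part_disjoint v h₂ h₁

/-- A class in `V^{-ε}` is pure: `a s ∈ ℤx ⊆ V^{ε}` forces `a s = 0`. [folklore] -/
private theorem pure_of_mem_part_neg {s : V} (hs : s ∈ S.part (-S.ε)) (a : ℤ)
    (h : a • s ∈ AddSubgroup.zmultiples S.x) : a • s = 0 := by
  obtain ⟨k, hk⟩ := AddSubgroup.mem_zmultiples_iff.mp h
  have h1 : a • s ∈ S.part S.ε := by rw [← hk]; exact (S.part S.ε).zsmul_mem S.x_part _
  exact S.eq_zero_of_mem_part_both h1 ((S.part (-S.ε)).zsmul_mem hs _)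

/-- Splitting off `x` (`ℤx` is a direct summand of `ℤx + ℤs`, `x` having the maximal order `p^M`):
`s = k x + s'` with `s'` PURE, `a s' ∈ ℤx ⟹ a s' = 0`. [folklore] -/
private theorem exists_split_pure (s : V) :
    ∃ (k : ℤ) (s' : V), s = k • S.x + s' ∧
      ∀ a : ℤ, a • s' ∈ AddSubgroup.zmultiples S.x → a • s' = 0 := by
  have hex : ∃ b : ℕ, ∃ k : ℤ, ((S.p : ℤ) ^ b) • s = k • S.x :=
    ⟨S.M, 0, by rw [S.torsion, zero_zsmul]⟩
  set b := Nat.find hex with hb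
  obtain ⟨k, hk⟩ : ∃ k : ℤ, ((S.p : ℤ) ^ b) • s = k • S.x := Nat.find_spec hex
  have hmin : ∀ j < b, ∀ k' : ℤ, ((S.p : ℤ) ^ j) • s ≠ k' • S.x := fun j hj k' h ↦
    Nat.find_min hex hj ⟨k', h⟩
  have hbM : b ≤ S.M := Nat.find_min' hex ⟨0, by rw [S.torsion, zero_zsmul]⟩
  have hdvd : ((S.p : ℤ) ^ b) ∣ k := by
    have h0 : (((S.p : ℤ) ^ (S.M - b)) * k) • S.x = 0 := by
      rw [mul_zsmul, ← hk, smul_smul, ← pow_add, Nat.sub_add_cancel hbM, S.torsion]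
    have h1 : (S.p : ℤ) ^ (S.M - b) * (S.p : ℤ) ^ b ∣ (S.p : ℤ) ^ (S.M - b) * k := by
      rw [← pow_add, Nat.sub_add_cancel hbM]
      exact (S.zsmul_x_eq_zero_iff' _).mp h0
    have hpne : ((S.p : ℤ) ^ (S.M - b)) ≠ 0 := pow_ne_zero _ (by exact_mod_cast S.hp.ne_zero)
    exact (mul_dvd_mul_iff_left hpne).mp h1
  obtain ⟨k', rfl⟩ := hdvd
  refine ⟨k', s - k' • S.x, by abel, fun a h ↦ ?_⟩
  have hs' : ((S.p : ℤ) ^ b) • (s - k' • S.x) = 0 := by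
    rw [zsmul_sub, hk, smul_smul]
    exact sub_self _
  by_cases ha : a = 0
  · rw [ha, zero_zsmul]
  obtain ⟨a₀, ha₀⟩ := AddSubgroup.mem_zmultiples_iff.mp h
  -- `a = p^j β`, `p ∤ β`
  obtain ⟨j, β, hβ, rfl⟩ : ∃ j : ℕ, ∃ β : ℤ, ¬ (S.p : ℤ) ∣ β ∧ a = (S.p : ℤ) ^ j * β := by
    have hfin : FiniteMultiplicity (S.p : ℤ) a :=
      Int.finiteMultiplicity_iff.mpr ⟨by rw [Int.natAbs_natCast]; exact S.hp.one_lt.ne', ha⟩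
    obtain ⟨β, hβ, hnd⟩ := hfin.exists_eq_pow_mul_and_not_dvd
    exact ⟨multiplicity (S.p : ℤ) a, β, hnd, hβ⟩
  rcases Nat.lt_or_ge j b with hjb | hjb
  · exfalso
    obtain ⟨u, hu⟩ := exists_mul_zsmul_eq_of_not_dvd S.hp S.torsion hβ
    have h2 : ((S.p : ℤ) ^ j) • (s - k' • S.x) = (u * a₀) • S.x :=
      calc ((S.p : ℤ) ^ j) • (s - k' • S.x)
          = (u * β) • (((S.p : ℤ) ^ j) • (s - k' • S.x)) := (hu _).symm
        _ = u • (((S.p : ℤ) ^ j * β) • (s - k' • S.x)) := by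
          rw [smul_smul, smul_smul]
          congr 1
          ring
        _ = u • (a₀ • S.x) := by rw [ha₀]
        _ = (u * a₀) • S.x := smul_smul _ _ _
    have h3 : ((S.p : ℤ) ^ j) • s =
        ((S.p : ℤ) ^ j) • (s - k' • S.x) + (((S.p : ℤ) ^ j) * k') • S.x := by
      rw [smul_sub, mul_smul]
      abel
    exact hmin j hjb _ (by rw [h3, h2, ← add_smul])
  · rw [mul_comm, mul_smul, pow_zsmul_eq_zero_of_le hjb hs', smul_zero]

/-- `z ↦ 0` in `Sel/ℤx` iff `z ∈ ℤx`. [folklore] -/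
private theorem quotient_mk_eq_zero_iff' (z : S.Sel) :
    (QuotientAddGroup.mk z : S.Sel ⧸ (AddSubgroup.zmultiples S.x).addSubgroupOf S.Sel) = 0 ↔
      (z : V) ∈ AddSubgroup.zmultiples S.x := by
  rw [QuotientAddGroup.eq_zero_iff, AddSubgroup.mem_addSubgroupOf]

/-- Membership in `ℤx ∩ Sel` (as a subgroup of `Sel`). [folklore] -/
private theorem mem_zmultiples_addSubgroupOf_iff' (z : S.Sel) :
    z ∈ (AddSubgroup.zmultiples S.x).addSubgroupOf S.Sel ↔ ∃ k : ℤ, z = k • ⟨S.x, S.x_mem⟩ := by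
  rw [AddSubgroup.mem_addSubgroupOf, AddSubgroup.mem_zmultiples_iff]
  constructor
  · rintro ⟨k, hk⟩
    exact ⟨k, Subtype.ext (by simpa using hk.symm)⟩
  · rintro ⟨k, rfl⟩
    exact ⟨k, by simp⟩

/-- A bi-additive pairing on `Sel` vanishing against `x` on both sides descends to `Sel/ℤx`.
[folklore] -/
private theorem exists_quotient_pairing' {R : Type*} [AddCommGroup R] (P : S.Sel →+ S.Sel →+ R)
    (hPx₁ : ∀ t, P ⟨S.x, S.x_mem⟩ t = 0) (hPx₂ : ∀ z, P z ⟨S.x, S.x_mem⟩ = 0) :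
    ∃ B : (S.Sel ⧸ (AddSubgroup.zmultiples S.x).addSubgroupOf S.Sel) →+
        (S.Sel ⧸ (AddSubgroup.zmultiples S.x).addSubgroupOf S.Sel) →+ R,
      ∀ z t : S.Sel, B (QuotientAddGroup.mk z) (QuotientAddGroup.mk t) = P z t := by
  set N := (AddSubgroup.zmultiples S.x).addSubgroupOf S.Sel with hN
  have hker : ∀ z : S.Sel, N ≤ (P z).ker := by
    intro z t ht
    rw [hN, S.mem_zmultiples_addSubgroupOf_iff'] at ht
    obtain ⟨k, rfl⟩ := ht
    rw [AddMonoidHom.mem_ker, map_zsmul, hPx₂, smul_zero]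
  let φ : S.Sel →+ ((S.Sel ⧸ N) →+ R) :=
    AddMonoidHom.mk' (fun z ↦ QuotientAddGroup.lift N (P z) (hker z)) fun z z' ↦ by
      apply QuotientAddGroup.addMonoidHom_ext
      ext t
      simp only [AddMonoidHom.coe_comp, Function.comp_apply, QuotientAddGroup.mk'_apply,
        QuotientAddGroup.lift_mk, map_add, AddMonoidHom.add_apply]
  have hφ : ∀ z t : S.Sel, φ z (QuotientAddGroup.mk t) = P z t := fun z t ↦ by
    simp only [φ, AddMonoidHom.mk'_apply, QuotientAddGroup.lift_mk]
  have hkerφ : N ≤ φ.ker := by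
    intro z hz
    rw [hN, S.mem_zmultiples_addSubgroupOf_iff'] at hz
    obtain ⟨k, rfl⟩ := hz
    rw [AddMonoidHom.mem_ker]
    apply QuotientAddGroup.addMonoidHom_ext
    ext t
    simp only [AddMonoidHom.coe_comp, Function.comp_apply, QuotientAddGroup.mk'_apply, hφ,
      map_zsmul, AddMonoidHom.zsmul_apply, hPx₁, smul_zero, AddMonoidHom.zero_apply]
  refine ⟨QuotientAddGroup.lift N φ hkerφ, fun z t ↦ ?_⟩
  rw [QuotientAddGroup.lift_mk, hφ]

/-- `#Sel = p^M · #(Sel/ℤx)` (`ord x = p^M`). [folklore] -/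
private theorem card_sel_eq' :
    Nat.card S.Sel =
      S.p ^ S.M * Nat.card (S.Sel ⧸ (AddSubgroup.zmultiples S.x).addSubgroupOf S.Sel) := by
  have hle : AddSubgroup.zmultiples S.x ≤ S.Sel := AddSubgroup.zmultiples_le.mpr S.x_mem
  rw [AddSubgroup.card_eq_card_quotient_mul_card_addSubgroup
    ((AddSubgroup.zmultiples S.x).addSubgroupOf S.Sel), mul_comm,
    Nat.card_congr (AddSubgroup.addSubgroupOfEquivOfLe hle).toEquiv, Nat.card_zmultiples,
    addOrderOf_eq_prime_pow S.hp (S.torsion S.x) S.x_ord]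

/-- A pure class has the same order as its image in `Sel/ℤx`. [folklore] -/
private theorem addOrderOf_mk_eq_of_pure' {w : V} (hw : w ∈ S.Sel)
    (hpure : ∀ a : ℤ, a • w ∈ AddSubgroup.zmultiples S.x → a • w = 0) :
    addOrderOf (QuotientAddGroup.mk ⟨w, hw⟩ :
      S.Sel ⧸ (AddSubgroup.zmultiples S.x).addSubgroupOf S.Sel) = S.p ^ S.expo w := by
  rw [← S.addOrderOf_eq_pow_expo' w, addOrderOf_eq_addOrderOf_iff]
  intro n
  rw [← QuotientAddGroup.mk_nsmul, S.quotient_mk_eq_zero_iff', AddSubgroupClass.coe_nsmul,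
    ← natCast_zsmul]
  exact ⟨fun h ↦ hpure _ h, fun h ↦ by rw [h]; exact zero_mem _⟩

/-- Splitting a sum over `1 ≤ i ≤ 2m` into odd and even indices. [folklore] -/
private theorem sum_Ioc_two_mul' {A : Type*} [AddCommMonoid A] (f : ℕ → A) (m : ℕ) :
    ∑ i ∈ Finset.Ioc 0 (2 * m), f i =
      ∑ j ∈ Finset.range m, f (2 * j + 1) + ∑ j ∈ Finset.range m, f (2 * j + 2) := by
  induction m with
  | zero => simp
  | succ m ih =>
    rw [show 2 * (m + 1) = 2 * m + 1 + 1 from rfl, Finset.sum_Ioc_succ_top (by omega),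
      Finset.sum_Ioc_succ_top (by omega), ih, Finset.sum_range_succ, Finset.sum_range_succ]
    abel

/-- A Lagrangian of an orthogonal summand: if `Q₀ ≤ Q` carries a non-degenerate restriction of an
alternating pairing `B` (in the sense: `q ∈ Q₀` killing `Q₀` is `0`), there is `L ≤ Q₀`, isotropic,
with `(#L)² = #Q₀`. [cite: Wall1963QuadraticFormsFiniteGroups, Lemma 7] -/
private theorem exists_lagrangian_of_subgroup {Q : Type*} [AddCommGroup Q] [Finite Q]
    (B : Q →+ Q →+ AddCircle (1 : ℚ)) (halt : ∀ q, B q q = 0) (Q₀ : AddSubgroup Q)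
    (hnd : ∀ q ∈ Q₀, (∀ r ∈ Q₀, B q r = 0) → q = 0) :
    ∃ L : AddSubgroup Q, L ≤ Q₀ ∧ (∀ a ∈ L, ∀ b ∈ L, B a b = 0) ∧ Nat.card L ^ 2 = Nat.card Q₀ := by
  set B₀ : Q₀ →+ Q₀ →+ AddCircle (1 : ℚ) := (B.comp Q₀.subtype).compl₂ Q₀.subtype with hB₀
  have hB₀ap : ∀ a b : Q₀, B₀ a b = B a b := fun a b ↦ rfl
  have halt₀ : ∀ a : Q₀, B₀ a a = 0 := fun a ↦ by rw [hB₀ap, halt]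
  have hnd₀ : ∀ a : Q₀, (∀ b, B₀ a b = 0) → a = 0 := fun a ha ↦
    Subtype.ext (hnd a a.2 fun r hr ↦ by rw [← hB₀ap a ⟨r, hr⟩]; exact ha _)
  obtain ⟨L₀, hiso, -, hcard⟩ := exists_lagrangian_sq_eq_card B₀ halt₀ hnd₀
  refine ⟨L₀.map Q₀.subtype, ?_, ?_, ?_⟩
  · intro q hq
    obtain ⟨a, -, rfl⟩ := AddSubgroup.mem_map.mp hq
    exact a.2
  · intro a ha b hb
    obtain ⟨a', ha', rfl⟩ := AddSubgroup.mem_map.mp ha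
    obtain ⟨b', hb', rfl⟩ := AddSubgroup.mem_map.mp hb
    rw [AddSubgroup.coe_subtype, ← hB₀ap]
    exact hiso a' ha' b' hb'
  · rw [← hcard, Nat.card_congr (L₀.equivMapOfInjective Q₀.subtype Subtype.val_injective).toEquiv]

/-! ### The bound -/

/-- **Kolyvagin's bound on the order of `Ш` (McCallum 1991, §1 Theorem), VISIBLE split form, any
prime `p`.** Let `P` be a bi-additive alternating pairing on `Sel` (the Cassels–Tate pairing pulled
back) which is cross-isotropic (`hPcross`), vanishes against `x` and is non-degenerate modulo
`ℤx`, with the value formula `hCTV` (Prop. 4.7, Lemma 5.3, Prop. 4.4 in order language), Čebotarev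
in the visible kernel form `hCeb` (Prop. 3.1 on two rays, for spans on which `rK` is injective —
McCallum p. 299), Lemma 4.3 for square-free `n` (`hcsupp`), and an annihilator `p^{E₀} Sel ⊆ ℤx`
with `E₀ + M₀ ≤ M`. Then **`#Sel ≤ p^M · p^{2M₀}`**. Proof = the sibling's (`Q = Sel/ℤx` is the
orthogonal direct sum of two symplectic pieces; Lagrangian generators lift to pure classes; the
visible telescope gives `∑ expo ≤ M₀`). At `2` for a visible pair:
`#Ш(E/ℚ)_{2^M} · #Ш(E^{(d_K)}/ℚ)_{2^M} ≤ 4^{M₀}`. [cite: McCallumLMS1991, §1 Theorem; Thm. 5.4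
(proof, p. 312), Cor. 5.6; Prop. 3.1, p. 299] [cite: Kolyvagin1989Izv, §3] -/
theorem card_sel_le_of_casselsTate [Finite S.Sel] (P : S.Sel →+ S.Sel →+ AddCircle (1 : ℚ))
    (halt : ∀ z, P z z = 0)
    (hPcross : ∀ z t : S.Sel, (z : V) ∈ S.part S.ε → (t : V) ∈ S.part (-S.ε) → P z t = 0)
    (hPx : ∀ t, P ⟨S.x, S.x_mem⟩ t = 0)
    (hnd : ∀ z : S.Sel, (∀ t, P z t = 0) → (z : V) ∈ AddSubgroup.zmultiples S.x)
    (hCTV : ∀ ℓ m : ℕ, S.Kol ℓ → KolSupp S.Kol (ℓ * m) → ¬ ℓ ∣ m →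
      ∀ (j N a b : ℕ) (t : V) (ht : t ∈ S.Sel) (hz : ((S.p : ℤ) ^ j) • S.c (ℓ * m) ∈ S.Sel),
      ((S.p : ℤ) ^ N) • t = 0 → t ∈ S.part (S.ε * (-1) ^ (ℓ * m).primeFactors.card) →
      (∀ q ∈ m.primeFactors, t ∈ S.A q) → S.M - S.M₀ ≤ j → N + S.M₀ ≤ S.M → N ≤ j → a + b + 1 = N →
      ((S.p : ℤ) ^ (a + (j - N))) • S.c m ∉ S.A ℓ → ((S.p : ℤ) ^ b) • t ∉ S.A ℓ →
      P ⟨_, hz⟩ ⟨t, ht⟩ ≠ 0)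
    (hCeb : ∀ (T : Finset V) (g₁ g₂ : V) (ν : ℤ), (ν = 1 ∨ ν = -1) → g₁ ∈ S.part ν →
      g₂ ∈ S.part (-ν) → (∀ t ∈ T, ∃ e : ℤ, (e = 1 ∨ e = -1) ∧ t ∈ S.part e) →
      (∀ g ∈ AddSubgroup.closure (insert g₁ (insert g₂ (T : Set V))), S.rK g = 0 → g = 0) →
      ∀ b : ℕ, ∃ ℓ, b < ℓ ∧ S.Kol ℓ ∧ (∀ t ∈ T, t ∈ S.A ℓ) ∧
        (∀ j : ℕ, ((S.p : ℤ) ^ j) • g₁ ∈ S.A ℓ ↔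
          ((S.p : ℤ) ^ j) • g₁ ∈ AddSubgroup.closure (T : Set V)) ∧
        (∀ j : ℕ, ((S.p : ℤ) ^ j) • g₂ ∈ S.A ℓ ↔
          ((S.p : ℤ) ^ j) • g₂ ∈ AddSubgroup.closure (T : Set V)))
    (hcsupp : ∀ n, KolSupp S.Kol n → ∀ v, (∀ q, S.Kol q → v ≠ S.pl q) → S.c n ∈ S.Loc v)
    {E₀ : ℕ} (hkill : ∀ t ∈ S.Sel, ((S.p : ℤ) ^ E₀) • t ∈ AddSubgroup.zmultiples S.x)
    (hE : E₀ + S.M₀ ≤ S.M) :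
    Nat.card S.Sel ≤ S.p ^ S.M * S.p ^ (2 * S.M₀) := by
  classical
  have hp := S.hp
  -- ### skew-symmetry; `P z x = 0`
  have hskew : ∀ z t, P z t = -P t z := fun z t ↦ by
    have h := halt (z + t)
    simp only [map_add, AddMonoidHom.add_apply, halt, zero_add, add_zero] at h
    exact eq_neg_of_add_eq_zero_right h
  have hPx' : ∀ z, P z ⟨S.x, S.x_mem⟩ = 0 := fun z ↦ by rw [hskew, hPx, neg_zero]
  have hPcross' : ∀ z t : S.Sel, (z : V) ∈ S.part (-S.ε) → (t : V) ∈ S.part S.ε → P z t = 0 :=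
    fun z t hz ht ↦ by rw [hskew, hPcross t z ht hz, neg_zero]
  -- ### the quotient `Q = Sel/ℤx`, its pairing, and the two pieces `Q^{±}`
  set N := (AddSubgroup.zmultiples S.x).addSubgroupOf S.Sel with hN
  obtain ⟨B, hB⟩ := S.exists_quotient_pairing' P hPx hPx'
  have haltB : ∀ q, B q q = 0 := fun q ↦ by
    induction q using QuotientAddGroup.induction_on with
    | H z => rw [hB, halt]
  have hndB : ∀ q, (∀ r, B q r = 0) → q = 0 := by
    intro q hq
    induction q using QuotientAddGroup.induction_on with
    | H z =>
      rw [S.quotient_mk_eq_zero_iff']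
      exact hnd z fun t ↦ by rw [← hB]; exact hq _
  set Selp : AddSubgroup S.Sel := (S.part S.ε).addSubgroupOf S.Sel with hSelp
  set Selm : AddSubgroup S.Sel := (S.part (-S.ε)).addSubgroupOf S.Sel with hSelm
  set Qp : AddSubgroup (S.Sel ⧸ N) := Selp.map (QuotientAddGroup.mk' N) with hQp
  set Qm : AddSubgroup (S.Sel ⧸ N) := Selm.map (QuotientAddGroup.mk' N) with hQm
  have hmemQp : ∀ {q}, q ∈ Qp ↔ ∃ z : S.Sel, (z : V) ∈ S.part S.ε ∧ QuotientAddGroup.mk z = q := by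
    intro q
    simp only [hQp, hSelp, AddSubgroup.mem_map, AddSubgroup.mem_addSubgroupOf,
      QuotientAddGroup.mk'_apply]
  have hmemQm : ∀ {q}, q ∈ Qm ↔
      ∃ z : S.Sel, (z : V) ∈ S.part (-S.ε) ∧ QuotientAddGroup.mk z = q := by
    intro q
    simp only [hQm, hSelm, AddSubgroup.mem_map, AddSubgroup.mem_addSubgroupOf,
      QuotientAddGroup.mk'_apply]
  -- `Q⁺ + Q⁻ = Q`
  have hsup : ∀ q : S.Sel ⧸ N, ∃ a ∈ Qp, ∃ b ∈ Qm, a + b = q := by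
    intro q
    induction q using QuotientAddGroup.induction_on with
    | H z =>
      obtain ⟨s₁, s₂, ⟨h₁, h₁'⟩, ⟨h₂, h₂'⟩, hsum⟩ := S.sel_split z z.2
      rcases S.hε with hε | hε
      · refine ⟨QuotientAddGroup.mk ⟨s₁, h₁⟩, hmemQp.mpr ⟨⟨s₁, h₁⟩, by rw [hε]; exact h₁', rfl⟩,
          QuotientAddGroup.mk ⟨s₂, h₂⟩, hmemQm.mpr ⟨⟨s₂, h₂⟩, by rw [hε]; exact h₂', rfl⟩, ?_⟩
        rw [← QuotientAddGroup.mk_add]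
        exact congrArg _ (Subtype.ext hsum.symm)
      · refine ⟨QuotientAddGroup.mk ⟨s₂, h₂⟩, hmemQp.mpr ⟨⟨s₂, h₂⟩, by rw [hε]; exact h₂', rfl⟩,
          QuotientAddGroup.mk ⟨s₁, h₁⟩,
          hmemQm.mpr ⟨⟨s₁, h₁⟩, by rw [hε, neg_neg]; exact h₁', rfl⟩, ?_⟩
        rw [← QuotientAddGroup.mk_add]
        exact congrArg _ (Subtype.ext (by rw [hsum, add_comm]; rfl))
  have hcodisj : Codisjoint Qp Qm := by
    rw [codisjoint_iff, eq_top_iff]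
    intro q _
    obtain ⟨a, ha, b, hb, rfl⟩ := hsup q
    exact AddSubgroup.add_mem_sup ha hb
  -- `Q⁺ ∩ Q⁻ = 0`
  have hdisj : Disjoint Qp Qm := by
    rw [AddSubgroup.disjoint_def]
    intro q hq₁ hq₂
    obtain ⟨z, hz, rfl⟩ := hmemQp.mp hq₁
    obtain ⟨t, ht, hzt⟩ := hmemQm.mp hq₂
    have hdiff : ((t : V) - z) ∈ AddSubgroup.zmultiples S.x := by
      have h0 : (QuotientAddGroup.mk (t - z) : S.Sel ⧸ N) = 0 := by
        rw [QuotientAddGroup.mk_sub, hzt, sub_self]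
      rw [S.quotient_mk_eq_zero_iff'] at h0
      simpa using h0
    have htε : (t : V) ∈ S.part S.ε := by
      obtain ⟨k, hk⟩ := AddSubgroup.mem_zmultiples_iff.mp hdiff
      have : (t : V) = k • S.x + z := by rw [hk]; abel
      rw [this]
      exact (S.part S.ε).add_mem ((S.part S.ε).zsmul_mem S.x_part _) hz
    have ht0 : t = 0 := Subtype.ext (S.eq_zero_of_mem_part_both htε ht)
    rw [← hzt, ht0, QuotientAddGroup.mk_zero]
  have hcompl : IsCompl Qp Qm := ⟨hdisj, hcodisj⟩
  -- orthogonality of the two pieces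
  have hBcross : ∀ a ∈ Qp, ∀ b ∈ Qm, B a b = 0 := by
    intro a ha b hb
    obtain ⟨z, hz, rfl⟩ := hmemQp.mp ha
    obtain ⟨t, ht, rfl⟩ := hmemQm.mp hb
    rw [hB]
    exact hPcross z t hz ht
  have hBcross' : ∀ a ∈ Qm, ∀ b ∈ Qp, B a b = 0 := by
    intro a ha b hb
    obtain ⟨z, hz, rfl⟩ := hmemQm.mp ha
    obtain ⟨t, ht, rfl⟩ := hmemQp.mp hb
    rw [hB]
    exact hPcross' z t hz ht
  -- non-degeneracy of each piece
  have hndp : ∀ q ∈ Qp, (∀ r ∈ Qp, B q r = 0) → q = 0 := by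
    intro q hq h
    refine hndB q fun r ↦ ?_
    obtain ⟨a, ha, b, hb, rfl⟩ := hsup r
    rw [map_add, h a ha, hBcross q hq b hb, add_zero]
  have hndm : ∀ q ∈ Qm, (∀ r ∈ Qm, B q r = 0) → q = 0 := by
    intro q hq h
    refine hndB q fun r ↦ ?_
    obtain ⟨a, ha, b, hb, rfl⟩ := hsup r
    rw [map_add, hBcross' q hq a ha, h b hb, zero_add]
  -- ### Lagrangians `La ≤ Q^{-ε}` (odd positions), `Lb ≤ Q^{ε}` (even positions)
  obtain ⟨La, hLaQ, hLa, hcardLa0⟩ := exists_lagrangian_of_subgroup B haltB Qm hndm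
  obtain ⟨Lb, hLbQ, hLb, hcardLb0⟩ := exists_lagrangian_of_subgroup B haltB Qp hndp
  have hisoab : ∀ a ∈ La ⊔ Lb, ∀ b ∈ La ⊔ Lb, B a b = 0 := by
    intro a ha b hb
    obtain ⟨a₁, ha₁, a₂, ha₂, rfl⟩ := AddSubgroup.mem_sup.mp ha
    obtain ⟨b₁, hb₁, b₂, hb₂, rfl⟩ := AddSubgroup.mem_sup.mp hb
    simp only [map_add, AddMonoidHom.add_apply, hLa a₁ ha₁ b₁ hb₁,
      hBcross' a₁ (hLaQ ha₁) b₂ (hLbQ hb₂), hBcross a₂ (hLbQ ha₂) b₁ (hLaQ hb₁), hLb a₂ ha₂ b₂ hb₂,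
      add_zero]
  have hdisjab : Disjoint La Lb := (hdisj.mono hLbQ hLaQ).symm
  have hQcard : Nat.card (S.Sel ⧸ N) = Nat.card La ^ 2 * Nat.card Lb ^ 2 := by
    rw [card_eq_mul_of_isCompl hcompl, ← hcardLa0, ← hcardLb0, mul_comm]
  -- ### generators of `La`, `Lb` of a common length `m`
  obtain ⟨ma, ga, hga⟩ := exists_indep_prod_addOrderOf_eq_card_le (G := La)
  obtain ⟨mb, gb, hgb⟩ := exists_indep_prod_addOrderOf_eq_card_le (G := Lb)
  obtain ⟨hgaind, hgacard⟩ := hga (max ma mb) (le_max_left _ _)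
  obtain ⟨hgbind, hgbcard⟩ := hgb (max ma mb) (le_max_right _ _)
  set m := max ma mb with hm
  -- ### pure lifts: `u_j ∈ Sel ∩ V^{-ε}` of `ga j`, `v_j ∈ Sel ∩ V^{ε}` of `gb j`
  have hliftm : ∀ q ∈ Qm, ∃ w : V, ∃ hw : w ∈ S.Sel,
      (QuotientAddGroup.mk ⟨w, hw⟩ : S.Sel ⧸ N) = q ∧ w ∈ S.part (-S.ε) ∧
        ∀ a : ℤ, a • w ∈ AddSubgroup.zmultiples S.x → a • w = 0 := by
    intro q hq
    obtain ⟨z, hz, rfl⟩ := hmemQm.mp hq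
    exact ⟨z, z.2, rfl, hz, S.pure_of_mem_part_neg hz⟩
  have hliftp : ∀ q ∈ Qp, ∃ w : V, ∃ hw : w ∈ S.Sel,
      (QuotientAddGroup.mk ⟨w, hw⟩ : S.Sel ⧸ N) = q ∧ w ∈ S.part S.ε ∧
        ∀ a : ℤ, a • w ∈ AddSubgroup.zmultiples S.x → a • w = 0 := by
    intro q hq
    obtain ⟨z, hz, rfl⟩ := hmemQp.mp hq
    obtain ⟨k, w, hzw, hpure⟩ := S.exists_split_pure (z : V)
    have hw : w = (z : V) - k • S.x := by rw [hzw]; abel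
    have hwS : w ∈ S.Sel := by rw [hw]; exact S.Sel.sub_mem z.2 (S.Sel.zsmul_mem S.x_mem _)
    have hwe : w ∈ S.part S.ε := by rw [hw]; exact (S.part S.ε).sub_mem hz ((S.part S.ε).zsmul_mem S.x_part _)
    refine ⟨w, hwS, ?_, hwe, hpure⟩
    rw [QuotientAddGroup.eq_iff_sub_mem, AddSubgroup.mem_addSubgroupOf]
    simp only [AddSubgroupClass.coe_sub, hw, sub_sub_cancel_left, neg_mem_iff]
    exact AddSubgroup.zsmul_mem _ (AddSubgroup.mem_zmultiples _) _
  choose u huS humk hτu hpu using fun j ↦ hliftm (ga j : _) (hLaQ (ga j).2)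
  choose v hvS hvmk hτv hpv using fun j ↦ hliftp (gb j : _) (hLbQ (gb j).2)
  have hmem_sup_u : ∀ j, (QuotientAddGroup.mk ⟨u j, huS j⟩ : S.Sel ⧸ N) ∈ La ⊔ Lb := fun j ↦ by
    rw [humk]; exact AddSubgroup.mem_sup_left (ga j).2
  have hmem_sup_v : ∀ j, (QuotientAddGroup.mk ⟨v j, hvS j⟩ : S.Sel ⧸ N) ∈ La ⊔ Lb := fun j ↦ by
    rw [hvmk]; exact AddSubgroup.mem_sup_right (gb j).2
  -- ### the interleaved family `s_{2j+1} = u_j`, `s_{2j+2} = v_j`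
  let s : ℕ → V := fun i ↦ if i % 2 = 1 then u (i / 2) else v (i / 2 - 1)
  have hs_odd : ∀ j, s (2 * j + 1) = u j := fun j ↦ by
    have h1 : (2 * j + 1) % 2 = 1 := by omega
    have h2 : (2 * j + 1) / 2 = j := by omega
    simp only [s, h1, if_true, h2]
  have hs_even : ∀ j, s (2 * j + 2) = v j := fun j ↦ by
    have h1 : ¬ ((2 * j + 2) % 2 = 1) := by omega
    have h2 : (2 * j + 2) / 2 - 1 = j := by omega
    simp only [s, h1, if_false, h2]
  have hsel : ∀ i, s i ∈ S.Sel := fun i ↦ by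
    simp only [s]
    split_ifs
    exacts [huS _, hvS _]
  have hspure : ∀ i (a : ℤ), a • s i ∈ AddSubgroup.zmultiples S.x → a • s i = 0 := fun i ↦ by
    simp only [s]
    split_ifs
    exacts [hpu _, hpv _]
  have hsmk : ∀ i, (QuotientAddGroup.mk ⟨s i, hsel i⟩ : S.Sel ⧸ N) ∈ La ⊔ Lb := fun i ↦ by
    by_cases hi : i % 2 = 1
    · have : (⟨s i, hsel i⟩ : S.Sel) = ⟨u (i / 2), huS _⟩ := Subtype.ext (by simp [s, hi])
      rw [this]; exact hmem_sup_u _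
    · have : (⟨s i, hsel i⟩ : S.Sel) = ⟨v (i / 2 - 1), hvS _⟩ := Subtype.ext (by simp [s, hi])
      rw [this]; exact hmem_sup_v _
  have hparity : ∀ i ∈ Finset.Ioc 0 (2 * m),
      (∃ j < m, i = 2 * j + 1) ∨ (∃ j < m, i = 2 * j + 2) := by
    intro i hi
    simp only [Finset.mem_Ioc] at hi
    rcases Nat.even_or_odd i with ⟨j, hj⟩ | ⟨j, hj⟩
    · right; exact ⟨j - 1, by omega, by omega⟩
    · left; exact ⟨j, by omega, by omega⟩
  -- ### the hypotheses of the telescope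
  have hτs : ∀ i ∈ Finset.Ioc 0 (2 * m), s i ∈ S.part (S.ε * (-1) ^ i) := by
    intro i hi
    rcases hparity i hi with ⟨j, -, rfl⟩ | ⟨j, -, rfl⟩
    · rw [hs_odd, pow_succ, pow_mul, neg_one_sq, one_pow, one_mul, mul_neg_one]
      exact hτu j
    · rw [hs_even, show 2 * j + 2 = 2 * (j + 1) by ring, pow_mul, neg_one_sq, one_pow, mul_one]
      exact hτv j
  have hiso : ∀ i ∈ Finset.Ioc 0 (2 * m), ∀ i' ∈ Finset.Ioc 0 (2 * m),
      P ⟨s i, hsel i⟩ ⟨s i', hsel i'⟩ = 0 := fun i _ i' _ ↦ by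
    rw [← hB]; exact hisoab _ (hsmk i) _ (hsmk i')
  have hQind : ∀ a : ℕ → ℤ, (∑ i ∈ Finset.Ioc 0 (2 * m), a i • s i) ∈ AddSubgroup.zmultiples S.x →
      ∀ i ∈ Finset.Ioc 0 (2 * m), a i • s i ∈ AddSubgroup.zmultiples S.x := by
    intro a ha i hi
    have hsum := sum_Ioc_two_mul' (fun i ↦ a i • s i) m
    simp only [hs_odd, hs_even] at hsum
    have hQ0 : (QuotientAddGroup.mk ⟨∑ i ∈ Finset.Ioc 0 (2 * m), a i • s i,
        S.Sel.sum_mem fun i _ ↦ S.Sel.zsmul_mem (hsel i) _⟩ : S.Sel ⧸ N) = 0 := by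
      rw [S.quotient_mk_eq_zero_iff']; exact ha
    have hA : (⟨∑ i ∈ Finset.Ioc 0 (2 * m), a i • s i,
        S.Sel.sum_mem fun i _ ↦ S.Sel.zsmul_mem (hsel i) _⟩ : S.Sel) =
        ∑ j ∈ Finset.range m, a (2 * j + 1) • ⟨u j, huS j⟩ +
          ∑ j ∈ Finset.range m, a (2 * j + 2) • ⟨v j, hvS j⟩ := by
      apply Subtype.ext
      simp only [hsum, AddSubgroup.coe_add, AddSubgroup.val_finsetSum, AddSubgroupClass.coe_zsmul]
    rw [hA, QuotientAddGroup.mk_add, QuotientAddGroup.mk_sum, QuotientAddGroup.mk_sum] at hQ0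
    simp only [QuotientAddGroup.mk_zsmul, humk, hvmk] at hQ0
    have hAmem : (∑ j ∈ Finset.range m, a (2 * j + 1) • (ga j : S.Sel ⧸ N)) ∈ La :=
      La.sum_mem fun j _ ↦ La.zsmul_mem (ga j).2 _
    have hBmem : (∑ j ∈ Finset.range m, a (2 * j + 2) • (gb j : S.Sel ⧸ N)) ∈ Lb :=
      Lb.sum_mem fun j _ ↦ Lb.zsmul_mem (gb j).2 _
    have hA0 : ∑ j ∈ Finset.range m, a (2 * j + 1) • (ga j : S.Sel ⧸ N) = 0 := by
      refine (AddSubgroup.disjoint_def.mp hdisjab) hAmem ?_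
      rw [eq_neg_of_add_eq_zero_left hQ0]
      exact Lb.neg_mem hBmem
    have hB0 : ∑ j ∈ Finset.range m, a (2 * j + 2) • (gb j : S.Sel ⧸ N) = 0 := by
      rwa [hA0, zero_add] at hQ0
    have hA0' : ∑ j ∈ Finset.range m, a (2 * j + 1) • ga j = 0 := by
      apply Subtype.ext
      simpa only [AddSubgroup.val_finsetSum, AddSubgroupClass.coe_zsmul, ZeroMemClass.coe_zero] using hA0
    have hB0' : ∑ j ∈ Finset.range m, a (2 * j + 2) • gb j = 0 := by
      apply Subtype.ext
      simpa only [AddSubgroup.val_finsetSum, AddSubgroupClass.coe_zsmul, ZeroMemClass.coe_zero] using hB0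
    rcases hparity i hi with ⟨j, hj, rfl⟩ | ⟨j, hj, rfl⟩
    · have h0 := hgaind (fun j ↦ a (2 * j + 1)) hA0' j (Finset.mem_range.mpr hj)
      have h0' : (a (2 * j + 1) • (ga j : S.Sel ⧸ N)) = 0 := by
        rw [← AddSubgroupClass.coe_zsmul, h0, ZeroMemClass.coe_zero]
      rw [← humk, ← QuotientAddGroup.mk_zsmul, S.quotient_mk_eq_zero_iff'] at h0'
      rw [hs_odd]
      simpa using h0'
    · have h0 := hgbind (fun j ↦ a (2 * j + 2)) hB0' j (Finset.mem_range.mpr hj)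
      have h0' : (a (2 * j + 2) • (gb j : S.Sel ⧸ N)) = 0 := by
        rw [← AddSubgroupClass.coe_zsmul, h0, ZeroMemClass.coe_zero]
      rw [← hvmk, ← QuotientAddGroup.mk_zsmul, S.quotient_mk_eq_zero_iff'] at h0'
      rw [hs_even]
      simpa using h0'
  have hind : ∀ (b : ℤ) (a : ℕ → ℤ), b • S.x + ∑ i ∈ Finset.Ioc 0 (2 * m), a i • s i = 0 →
      b • S.x = 0 ∧ ∀ i ∈ Finset.Ioc 0 (2 * m), a i • s i = 0 := by
    intro b a h
    have hsumx : (∑ i ∈ Finset.Ioc 0 (2 * m), a i • s i) ∈ AddSubgroup.zmultiples S.x := by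
      have : ∑ i ∈ Finset.Ioc 0 (2 * m), a i • s i = (-b) • S.x := by
        rw [neg_smul, eq_neg_iff_add_eq_zero, add_comm, h]
      rw [this]
      exact AddSubgroup.zsmul_mem _ (AddSubgroup.mem_zmultiples _) _
    have h0 : ∀ i ∈ Finset.Ioc 0 (2 * m), a i • s i = 0 := fun i hi ↦
      hspure i (a i) (hQind a hsumx i hi)
    refine ⟨?_, h0⟩
    rwa [Finset.sum_eq_zero h0, add_zero] at h
  have hroom : ∀ i ∈ Finset.Ioc 0 (2 * m), S.expo (s i) + S.M₀ ≤ S.M := fun i _ ↦ by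
    have := S.expo_le_of_pow_zsmul_eq_zero' (hspure i _ (hkill (s i) (hsel i)))
    omega
  -- ### the telescope: `∑ expo sᵢ ≤ M₀`
  have hsumexpo := S.sum_expo_le_M₀_of_casselsTate P hCTV hCeb hcsupp (2 * m) s hsel hτs hiso hind hroom
  rw [sum_Ioc_two_mul' (fun i ↦ S.expo (s i)) m] at hsumexpo
  simp only [hs_odd, hs_even] at hsumexpo
  -- ### counting: `#Q = (#La #Lb)² = p^{2 ∑ expo}`
  have hordu : ∀ j, addOrderOf (ga j) = S.p ^ S.expo (u j) := fun j ↦ by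
    rw [← addOrderOf_injective La.subtype Subtype.val_injective (ga j), AddSubgroup.coe_subtype,
      ← humk, S.addOrderOf_mk_eq_of_pure' (huS j) (hpu j)]
  have hordv : ∀ j, addOrderOf (gb j) = S.p ^ S.expo (v j) := fun j ↦ by
    rw [← addOrderOf_injective Lb.subtype Subtype.val_injective (gb j), AddSubgroup.coe_subtype,
      ← hvmk, S.addOrderOf_mk_eq_of_pure' (hvS j) (hpv j)]
  have hcardLa : Nat.card La = S.p ^ ∑ j ∈ Finset.range m, S.expo (u j) := by
    rw [hgacard, Finset.prod_congr rfl fun j _ ↦ hordu j, Finset.prod_pow_eq_pow_sum]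
  have hcardLb : Nat.card Lb = S.p ^ ∑ j ∈ Finset.range m, S.expo (v j) := by
    rw [hgbcard, Finset.prod_congr rfl fun j _ ↦ hordv j, Finset.prod_pow_eq_pow_sum]
  rw [S.card_sel_eq', hQcard, hcardLa, hcardLb]
  apply Nat.mul_le_mul_left
  rw [← pow_mul, ← pow_mul, ← pow_add]
  exact Nat.pow_le_pow_right hp.pos (by omega)

/-- **Kolyvagin's bound, quotient form, visible data**: under the hypotheses of
`card_sel_le_of_casselsTate`, `#(Sel/ℤx) ≤ p^{2M₀}`. [cite: McCallumLMS1991, §1 Theorem; Cor. 5.6] -/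
theorem card_quotient_le_of_casselsTate [Finite S.Sel] (P : S.Sel →+ S.Sel →+ AddCircle (1 : ℚ))
    (halt : ∀ z, P z z = 0)
    (hPcross : ∀ z t : S.Sel, (z : V) ∈ S.part S.ε → (t : V) ∈ S.part (-S.ε) → P z t = 0)
    (hPx : ∀ t, P ⟨S.x, S.x_mem⟩ t = 0)
    (hnd : ∀ z : S.Sel, (∀ t, P z t = 0) → (z : V) ∈ AddSubgroup.zmultiples S.x)
    (hCTV : ∀ ℓ m : ℕ, S.Kol ℓ → KolSupp S.Kol (ℓ * m) → ¬ ℓ ∣ m →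
      ∀ (j N a b : ℕ) (t : V) (ht : t ∈ S.Sel) (hz : ((S.p : ℤ) ^ j) • S.c (ℓ * m) ∈ S.Sel),
      ((S.p : ℤ) ^ N) • t = 0 → t ∈ S.part (S.ε * (-1) ^ (ℓ * m).primeFactors.card) →
      (∀ q ∈ m.primeFactors, t ∈ S.A q) → S.M - S.M₀ ≤ j → N + S.M₀ ≤ S.M → N ≤ j → a + b + 1 = N →
      ((S.p : ℤ) ^ (a + (j - N))) • S.c m ∉ S.A ℓ → ((S.p : ℤ) ^ b) • t ∉ S.A ℓ →
      P ⟨_, hz⟩ ⟨t, ht⟩ ≠ 0)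
    (hCeb : ∀ (T : Finset V) (g₁ g₂ : V) (ν : ℤ), (ν = 1 ∨ ν = -1) → g₁ ∈ S.part ν →
      g₂ ∈ S.part (-ν) → (∀ t ∈ T, ∃ e : ℤ, (e = 1 ∨ e = -1) ∧ t ∈ S.part e) →
      (∀ g ∈ AddSubgroup.closure (insert g₁ (insert g₂ (T : Set V))), S.rK g = 0 → g = 0) →
      ∀ b : ℕ, ∃ ℓ, b < ℓ ∧ S.Kol ℓ ∧ (∀ t ∈ T, t ∈ S.A ℓ) ∧
        (∀ j : ℕ, ((S.p : ℤ) ^ j) • g₁ ∈ S.A ℓ ↔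
          ((S.p : ℤ) ^ j) • g₁ ∈ AddSubgroup.closure (T : Set V)) ∧
        (∀ j : ℕ, ((S.p : ℤ) ^ j) • g₂ ∈ S.A ℓ ↔
          ((S.p : ℤ) ^ j) • g₂ ∈ AddSubgroup.closure (T : Set V)))
    (hcsupp : ∀ n, KolSupp S.Kol n → ∀ v, (∀ q, S.Kol q → v ≠ S.pl q) → S.c n ∈ S.Loc v)
    {E₀ : ℕ} (hkill : ∀ t ∈ S.Sel, ((S.p : ℤ) ^ E₀) • t ∈ AddSubgroup.zmultiples S.x)
    (hE : E₀ + S.M₀ ≤ S.M) :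
    Nat.card (S.Sel ⧸ (AddSubgroup.zmultiples S.x).addSubgroupOf S.Sel) ≤ S.p ^ (2 * S.M₀) := by
  have h := S.card_sel_le_of_casselsTate P halt hPcross hPx hnd hCTV hCeb hcsupp hkill hE
  rw [S.card_sel_eq'] at h
  exact Nat.le_of_mul_le_mul_left h (pow_pos S.hp.pos _)

/-! ### The bound with the value formula restricted to `p^{2M₀}`-torsion classes

Appended by the BSD route `GenusKolyvaginAtTwo` (seat `bsd-line-gk2-p2` g12): `card_sel_le_of_casselsTate`
VERBATIM, with `hCTV` assumed only for `t` with `p^{2M₀} t = 0` (the telescope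
`sum_expo_le_M₀_of_casselsTate_of_torsion` needs no more) — the form in which the Cassels–Tate pairing
pulled back to `S_{p^M}` actually satisfies it. -/

/-- **Kolyvagin's bound `#Sel ≤ p^M · p^{2M₀}`, VISIBLE data, value formula on `p^{2M₀}`-torsion classes
only.** As `card_sel_le_of_casselsTate`, with the restricted `hCTV` of
`sum_expo_le_M₀_of_casselsTate_of_torsion`. [cite: McCallumLMS1991, §1 Theorem; Thm. 5.4 (proof); Cor. 5.6]
[cite: Kolyvagin1989Izv, §3] -/
theorem card_sel_le_of_casselsTate_of_torsion [Finite S.Sel] (P : S.Sel →+ S.Sel →+ AddCircle (1 : ℚ))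
    (halt : ∀ z, P z z = 0)
    (hPcross : ∀ z t : S.Sel, (z : V) ∈ S.part S.ε → (t : V) ∈ S.part (-S.ε) → P z t = 0)
    (hPx : ∀ t, P ⟨S.x, S.x_mem⟩ t = 0)
    (hnd : ∀ z : S.Sel, (∀ t, P z t = 0) → (z : V) ∈ AddSubgroup.zmultiples S.x)
    (hCTV : ∀ ℓ m : ℕ, S.Kol ℓ → KolSupp S.Kol (ℓ * m) → ¬ ℓ ∣ m →
      ∀ (j N a b : ℕ) (t : V) (ht : t ∈ S.Sel) (hz : ((S.p : ℤ) ^ j) • S.c (ℓ * m) ∈ S.Sel),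
      ((S.p : ℤ) ^ N) • t = 0 → ((S.p : ℤ) ^ (2 * S.M₀)) • t = 0 →
      t ∈ S.part (S.ε * (-1) ^ (ℓ * m).primeFactors.card) →
      (∀ q ∈ m.primeFactors, t ∈ S.A q) → S.M - S.M₀ ≤ j → N + S.M₀ ≤ S.M → N ≤ j → a + b + 1 = N →
      ((S.p : ℤ) ^ (a + (j - N))) • S.c m ∉ S.A ℓ → ((S.p : ℤ) ^ b) • t ∉ S.A ℓ →
      P ⟨_, hz⟩ ⟨t, ht⟩ ≠ 0)
    (hCeb : ∀ (T : Finset V) (g₁ g₂ : V) (ν : ℤ), (ν = 1 ∨ ν = -1) → g₁ ∈ S.part ν →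
      g₂ ∈ S.part (-ν) → (∀ t ∈ T, ∃ e : ℤ, (e = 1 ∨ e = -1) ∧ t ∈ S.part e) →
      (∀ g ∈ AddSubgroup.closure (insert g₁ (insert g₂ (T : Set V))), S.rK g = 0 → g = 0) →
      ∀ b : ℕ, ∃ ℓ, b < ℓ ∧ S.Kol ℓ ∧ (∀ t ∈ T, t ∈ S.A ℓ) ∧
        (∀ j : ℕ, ((S.p : ℤ) ^ j) • g₁ ∈ S.A ℓ ↔
          ((S.p : ℤ) ^ j) • g₁ ∈ AddSubgroup.closure (T : Set V)) ∧
        (∀ j : ℕ, ((S.p : ℤ) ^ j) • g₂ ∈ S.A ℓ ↔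
          ((S.p : ℤ) ^ j) • g₂ ∈ AddSubgroup.closure (T : Set V)))
    (hcsupp : ∀ n, KolSupp S.Kol n → ∀ v, (∀ q, S.Kol q → v ≠ S.pl q) → S.c n ∈ S.Loc v)
    {E₀ : ℕ} (hkill : ∀ t ∈ S.Sel, ((S.p : ℤ) ^ E₀) • t ∈ AddSubgroup.zmultiples S.x)
    (hE : E₀ + S.M₀ ≤ S.M) :
    Nat.card S.Sel ≤ S.p ^ S.M * S.p ^ (2 * S.M₀) := by
  classical
  have hp := S.hp
  -- ### skew-symmetry; `P z x = 0`
  have hskew : ∀ z t, P z t = -P t z := fun z t ↦ by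
    have h := halt (z + t)
    simp only [map_add, AddMonoidHom.add_apply, halt, zero_add, add_zero] at h
    exact eq_neg_of_add_eq_zero_right h
  have hPx' : ∀ z, P z ⟨S.x, S.x_mem⟩ = 0 := fun z ↦ by rw [hskew, hPx, neg_zero]
  have hPcross' : ∀ z t : S.Sel, (z : V) ∈ S.part (-S.ε) → (t : V) ∈ S.part S.ε → P z t = 0 :=
    fun z t hz ht ↦ by rw [hskew, hPcross t z ht hz, neg_zero]
  -- ### the quotient `Q = Sel/ℤx`, its pairing, and the two pieces `Q^{±}`
  set N := (AddSubgroup.zmultiples S.x).addSubgroupOf S.Sel with hN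
  obtain ⟨B, hB⟩ := S.exists_quotient_pairing' P hPx hPx'
  have haltB : ∀ q, B q q = 0 := fun q ↦ by
    induction q using QuotientAddGroup.induction_on with
    | H z => rw [hB, halt]
  have hndB : ∀ q, (∀ r, B q r = 0) → q = 0 := by
    intro q hq
    induction q using QuotientAddGroup.induction_on with
    | H z =>
      rw [S.quotient_mk_eq_zero_iff']
      exact hnd z fun t ↦ by rw [← hB]; exact hq _
  set Selp : AddSubgroup S.Sel := (S.part S.ε).addSubgroupOf S.Sel with hSelp
  set Selm : AddSubgroup S.Sel := (S.part (-S.ε)).addSubgroupOf S.Sel with hSelm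
  set Qp : AddSubgroup (S.Sel ⧸ N) := Selp.map (QuotientAddGroup.mk' N) with hQp
  set Qm : AddSubgroup (S.Sel ⧸ N) := Selm.map (QuotientAddGroup.mk' N) with hQm
  have hmemQp : ∀ {q}, q ∈ Qp ↔ ∃ z : S.Sel, (z : V) ∈ S.part S.ε ∧ QuotientAddGroup.mk z = q := by
    intro q
    simp only [hQp, hSelp, AddSubgroup.mem_map, AddSubgroup.mem_addSubgroupOf,
      QuotientAddGroup.mk'_apply]
  have hmemQm : ∀ {q}, q ∈ Qm ↔
      ∃ z : S.Sel, (z : V) ∈ S.part (-S.ε) ∧ QuotientAddGroup.mk z = q := by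
    intro q
    simp only [hQm, hSelm, AddSubgroup.mem_map, AddSubgroup.mem_addSubgroupOf,
      QuotientAddGroup.mk'_apply]
  -- `Q⁺ + Q⁻ = Q`
  have hsup : ∀ q : S.Sel ⧸ N, ∃ a ∈ Qp, ∃ b ∈ Qm, a + b = q := by
    intro q
    induction q using QuotientAddGroup.induction_on with
    | H z =>
      obtain ⟨s₁, s₂, ⟨h₁, h₁'⟩, ⟨h₂, h₂'⟩, hsum⟩ := S.sel_split z z.2
      rcases S.hε with hε | hε
      · refine ⟨QuotientAddGroup.mk ⟨s₁, h₁⟩, hmemQp.mpr ⟨⟨s₁, h₁⟩, by rw [hε]; exact h₁', rfl⟩,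
          QuotientAddGroup.mk ⟨s₂, h₂⟩, hmemQm.mpr ⟨⟨s₂, h₂⟩, by rw [hε]; exact h₂', rfl⟩, ?_⟩
        rw [← QuotientAddGroup.mk_add]
        exact congrArg _ (Subtype.ext hsum.symm)
      · refine ⟨QuotientAddGroup.mk ⟨s₂, h₂⟩, hmemQp.mpr ⟨⟨s₂, h₂⟩, by rw [hε]; exact h₂', rfl⟩,
          QuotientAddGroup.mk ⟨s₁, h₁⟩,
          hmemQm.mpr ⟨⟨s₁, h₁⟩, by rw [hε, neg_neg]; exact h₁', rfl⟩, ?_⟩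
        rw [← QuotientAddGroup.mk_add]
        exact congrArg _ (Subtype.ext (by rw [hsum, add_comm]; rfl))
  have hcodisj : Codisjoint Qp Qm := by
    rw [codisjoint_iff, eq_top_iff]
    intro q _
    obtain ⟨a, ha, b, hb, rfl⟩ := hsup q
    exact AddSubgroup.add_mem_sup ha hb
  -- `Q⁺ ∩ Q⁻ = 0`
  have hdisj : Disjoint Qp Qm := by
    rw [AddSubgroup.disjoint_def]
    intro q hq₁ hq₂
    obtain ⟨z, hz, rfl⟩ := hmemQp.mp hq₁
    obtain ⟨t, ht, hzt⟩ := hmemQm.mp hq₂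
    have hdiff : ((t : V) - z) ∈ AddSubgroup.zmultiples S.x := by
      have h0 : (QuotientAddGroup.mk (t - z) : S.Sel ⧸ N) = 0 := by
        rw [QuotientAddGroup.mk_sub, hzt, sub_self]
      rw [S.quotient_mk_eq_zero_iff'] at h0
      simpa using h0
    have htε : (t : V) ∈ S.part S.ε := by
      obtain ⟨k, hk⟩ := AddSubgroup.mem_zmultiples_iff.mp hdiff
      have : (t : V) = k • S.x + z := by rw [hk]; abel
      rw [this]
      exact (S.part S.ε).add_mem ((S.part S.ε).zsmul_mem S.x_part _) hz
    have ht0 : t = 0 := Subtype.ext (S.eq_zero_of_mem_part_both htε ht)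
    rw [← hzt, ht0, QuotientAddGroup.mk_zero]
  have hcompl : IsCompl Qp Qm := ⟨hdisj, hcodisj⟩
  -- orthogonality of the two pieces
  have hBcross : ∀ a ∈ Qp, ∀ b ∈ Qm, B a b = 0 := by
    intro a ha b hb
    obtain ⟨z, hz, rfl⟩ := hmemQp.mp ha
    obtain ⟨t, ht, rfl⟩ := hmemQm.mp hb
    rw [hB]
    exact hPcross z t hz ht
  have hBcross' : ∀ a ∈ Qm, ∀ b ∈ Qp, B a b = 0 := by
    intro a ha b hb
    obtain ⟨z, hz, rfl⟩ := hmemQm.mp ha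
    obtain ⟨t, ht, rfl⟩ := hmemQp.mp hb
    rw [hB]
    exact hPcross' z t hz ht
  -- non-degeneracy of each piece
  have hndp : ∀ q ∈ Qp, (∀ r ∈ Qp, B q r = 0) → q = 0 := by
    intro q hq h
    refine hndB q fun r ↦ ?_
    obtain ⟨a, ha, b, hb, rfl⟩ := hsup r
    rw [map_add, h a ha, hBcross q hq b hb, add_zero]
  have hndm : ∀ q ∈ Qm, (∀ r ∈ Qm, B q r = 0) → q = 0 := by
    intro q hq h
    refine hndB q fun r ↦ ?_
    obtain ⟨a, ha, b, hb, rfl⟩ := hsup r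
    rw [map_add, hBcross' q hq a ha, h b hb, zero_add]
  -- ### Lagrangians `La ≤ Q^{-ε}` (odd positions), `Lb ≤ Q^{ε}` (even positions)
  obtain ⟨La, hLaQ, hLa, hcardLa0⟩ := exists_lagrangian_of_subgroup B haltB Qm hndm
  obtain ⟨Lb, hLbQ, hLb, hcardLb0⟩ := exists_lagrangian_of_subgroup B haltB Qp hndp
  have hisoab : ∀ a ∈ La ⊔ Lb, ∀ b ∈ La ⊔ Lb, B a b = 0 := by
    intro a ha b hb
    obtain ⟨a₁, ha₁, a₂, ha₂, rfl⟩ := AddSubgroup.mem_sup.mp ha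
    obtain ⟨b₁, hb₁, b₂, hb₂, rfl⟩ := AddSubgroup.mem_sup.mp hb
    simp only [map_add, AddMonoidHom.add_apply, hLa a₁ ha₁ b₁ hb₁,
      hBcross' a₁ (hLaQ ha₁) b₂ (hLbQ hb₂), hBcross a₂ (hLbQ ha₂) b₁ (hLaQ hb₁), hLb a₂ ha₂ b₂ hb₂,
      add_zero]
  have hdisjab : Disjoint La Lb := (hdisj.mono hLbQ hLaQ).symm
  have hQcard : Nat.card (S.Sel ⧸ N) = Nat.card La ^ 2 * Nat.card Lb ^ 2 := by
    rw [card_eq_mul_of_isCompl hcompl, ← hcardLa0, ← hcardLb0, mul_comm]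
  -- ### generators of `La`, `Lb` of a common length `m`
  obtain ⟨ma, ga, hga⟩ := exists_indep_prod_addOrderOf_eq_card_le (G := La)
  obtain ⟨mb, gb, hgb⟩ := exists_indep_prod_addOrderOf_eq_card_le (G := Lb)
  obtain ⟨hgaind, hgacard⟩ := hga (max ma mb) (le_max_left _ _)
  obtain ⟨hgbind, hgbcard⟩ := hgb (max ma mb) (le_max_right _ _)
  set m := max ma mb with hm
  -- ### pure lifts: `u_j ∈ Sel ∩ V^{-ε}` of `ga j`, `v_j ∈ Sel ∩ V^{ε}` of `gb j`
  have hliftm : ∀ q ∈ Qm, ∃ w : V, ∃ hw : w ∈ S.Sel,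
      (QuotientAddGroup.mk ⟨w, hw⟩ : S.Sel ⧸ N) = q ∧ w ∈ S.part (-S.ε) ∧
        ∀ a : ℤ, a • w ∈ AddSubgroup.zmultiples S.x → a • w = 0 := by
    intro q hq
    obtain ⟨z, hz, rfl⟩ := hmemQm.mp hq
    exact ⟨z, z.2, rfl, hz, S.pure_of_mem_part_neg hz⟩
  have hliftp : ∀ q ∈ Qp, ∃ w : V, ∃ hw : w ∈ S.Sel,
      (QuotientAddGroup.mk ⟨w, hw⟩ : S.Sel ⧸ N) = q ∧ w ∈ S.part S.ε ∧
        ∀ a : ℤ, a • w ∈ AddSubgroup.zmultiples S.x → a • w = 0 := by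
    intro q hq
    obtain ⟨z, hz, rfl⟩ := hmemQp.mp hq
    obtain ⟨k, w, hzw, hpure⟩ := S.exists_split_pure (z : V)
    have hw : w = (z : V) - k • S.x := by rw [hzw]; abel
    have hwS : w ∈ S.Sel := by rw [hw]; exact S.Sel.sub_mem z.2 (S.Sel.zsmul_mem S.x_mem _)
    have hwe : w ∈ S.part S.ε := by rw [hw]; exact (S.part S.ε).sub_mem hz ((S.part S.ε).zsmul_mem S.x_part _)
    refine ⟨w, hwS, ?_, hwe, hpure⟩
    rw [QuotientAddGroup.eq_iff_sub_mem, AddSubgroup.mem_addSubgroupOf]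
    simp only [AddSubgroupClass.coe_sub, hw, sub_sub_cancel_left, neg_mem_iff]
    exact AddSubgroup.zsmul_mem _ (AddSubgroup.mem_zmultiples _) _
  choose u huS humk hτu hpu using fun j ↦ hliftm (ga j : _) (hLaQ (ga j).2)
  choose v hvS hvmk hτv hpv using fun j ↦ hliftp (gb j : _) (hLbQ (gb j).2)
  have hmem_sup_u : ∀ j, (QuotientAddGroup.mk ⟨u j, huS j⟩ : S.Sel ⧸ N) ∈ La ⊔ Lb := fun j ↦ by
    rw [humk]; exact AddSubgroup.mem_sup_left (ga j).2
  have hmem_sup_v : ∀ j, (QuotientAddGroup.mk ⟨v j, hvS j⟩ : S.Sel ⧸ N) ∈ La ⊔ Lb := fun j ↦ by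
    rw [hvmk]; exact AddSubgroup.mem_sup_right (gb j).2
  -- ### the interleaved family `s_{2j+1} = u_j`, `s_{2j+2} = v_j`
  let s : ℕ → V := fun i ↦ if i % 2 = 1 then u (i / 2) else v (i / 2 - 1)
  have hs_odd : ∀ j, s (2 * j + 1) = u j := fun j ↦ by
    have h1 : (2 * j + 1) % 2 = 1 := by omega
    have h2 : (2 * j + 1) / 2 = j := by omega
    simp only [s, h1, if_true, h2]
  have hs_even : ∀ j, s (2 * j + 2) = v j := fun j ↦ by
    have h1 : ¬ ((2 * j + 2) % 2 = 1) := by omega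
    have h2 : (2 * j + 2) / 2 - 1 = j := by omega
    simp only [s, h1, if_false, h2]
  have hsel : ∀ i, s i ∈ S.Sel := fun i ↦ by
    simp only [s]
    split_ifs
    exacts [huS _, hvS _]
  have hspure : ∀ i (a : ℤ), a • s i ∈ AddSubgroup.zmultiples S.x → a • s i = 0 := fun i ↦ by
    simp only [s]
    split_ifs
    exacts [hpu _, hpv _]
  have hsmk : ∀ i, (QuotientAddGroup.mk ⟨s i, hsel i⟩ : S.Sel ⧸ N) ∈ La ⊔ Lb := fun i ↦ by
    by_cases hi : i % 2 = 1
    · have : (⟨s i, hsel i⟩ : S.Sel) = ⟨u (i / 2), huS _⟩ := Subtype.ext (by simp [s, hi])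
      rw [this]; exact hmem_sup_u _
    · have : (⟨s i, hsel i⟩ : S.Sel) = ⟨v (i / 2 - 1), hvS _⟩ := Subtype.ext (by simp [s, hi])
      rw [this]; exact hmem_sup_v _
  have hparity : ∀ i ∈ Finset.Ioc 0 (2 * m),
      (∃ j < m, i = 2 * j + 1) ∨ (∃ j < m, i = 2 * j + 2) := by
    intro i hi
    simp only [Finset.mem_Ioc] at hi
    rcases Nat.even_or_odd i with ⟨j, hj⟩ | ⟨j, hj⟩
    · right; exact ⟨j - 1, by omega, by omega⟩
    · left; exact ⟨j, by omega, by omega⟩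
  -- ### the hypotheses of the telescope
  have hτs : ∀ i ∈ Finset.Ioc 0 (2 * m), s i ∈ S.part (S.ε * (-1) ^ i) := by
    intro i hi
    rcases hparity i hi with ⟨j, -, rfl⟩ | ⟨j, -, rfl⟩
    · rw [hs_odd, pow_succ, pow_mul, neg_one_sq, one_pow, one_mul, mul_neg_one]
      exact hτu j
    · rw [hs_even, show 2 * j + 2 = 2 * (j + 1) by ring, pow_mul, neg_one_sq, one_pow, mul_one]
      exact hτv j
  have hiso : ∀ i ∈ Finset.Ioc 0 (2 * m), ∀ i' ∈ Finset.Ioc 0 (2 * m),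
      P ⟨s i, hsel i⟩ ⟨s i', hsel i'⟩ = 0 := fun i _ i' _ ↦ by
    rw [← hB]; exact hisoab _ (hsmk i) _ (hsmk i')
  have hQind : ∀ a : ℕ → ℤ, (∑ i ∈ Finset.Ioc 0 (2 * m), a i • s i) ∈ AddSubgroup.zmultiples S.x →
      ∀ i ∈ Finset.Ioc 0 (2 * m), a i • s i ∈ AddSubgroup.zmultiples S.x := by
    intro a ha i hi
    have hsum := sum_Ioc_two_mul' (fun i ↦ a i • s i) m
    simp only [hs_odd, hs_even] at hsum
    have hQ0 : (QuotientAddGroup.mk ⟨∑ i ∈ Finset.Ioc 0 (2 * m), a i • s i,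
        S.Sel.sum_mem fun i _ ↦ S.Sel.zsmul_mem (hsel i) _⟩ : S.Sel ⧸ N) = 0 := by
      rw [S.quotient_mk_eq_zero_iff']; exact ha
    have hA : (⟨∑ i ∈ Finset.Ioc 0 (2 * m), a i • s i,
        S.Sel.sum_mem fun i _ ↦ S.Sel.zsmul_mem (hsel i) _⟩ : S.Sel) =
        ∑ j ∈ Finset.range m, a (2 * j + 1) • ⟨u j, huS j⟩ +
          ∑ j ∈ Finset.range m, a (2 * j + 2) • ⟨v j, hvS j⟩ := by
      apply Subtype.ext
      simp only [hsum, AddSubgroup.coe_add, AddSubgroup.val_finsetSum, AddSubgroupClass.coe_zsmul]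
    rw [hA, QuotientAddGroup.mk_add, QuotientAddGroup.mk_sum, QuotientAddGroup.mk_sum] at hQ0
    simp only [QuotientAddGroup.mk_zsmul, humk, hvmk] at hQ0
    have hAmem : (∑ j ∈ Finset.range m, a (2 * j + 1) • (ga j : S.Sel ⧸ N)) ∈ La :=
      La.sum_mem fun j _ ↦ La.zsmul_mem (ga j).2 _
    have hBmem : (∑ j ∈ Finset.range m, a (2 * j + 2) • (gb j : S.Sel ⧸ N)) ∈ Lb :=
      Lb.sum_mem fun j _ ↦ Lb.zsmul_mem (gb j).2 _
    have hA0 : ∑ j ∈ Finset.range m, a (2 * j + 1) • (ga j : S.Sel ⧸ N) = 0 := by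
      refine (AddSubgroup.disjoint_def.mp hdisjab) hAmem ?_
      rw [eq_neg_of_add_eq_zero_left hQ0]
      exact Lb.neg_mem hBmem
    have hB0 : ∑ j ∈ Finset.range m, a (2 * j + 2) • (gb j : S.Sel ⧸ N) = 0 := by
      rwa [hA0, zero_add] at hQ0
    have hA0' : ∑ j ∈ Finset.range m, a (2 * j + 1) • ga j = 0 := by
      apply Subtype.ext
      simpa only [AddSubgroup.val_finsetSum, AddSubgroupClass.coe_zsmul, ZeroMemClass.coe_zero] using hA0
    have hB0' : ∑ j ∈ Finset.range m, a (2 * j + 2) • gb j = 0 := by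
      apply Subtype.ext
      simpa only [AddSubgroup.val_finsetSum, AddSubgroupClass.coe_zsmul, ZeroMemClass.coe_zero] using hB0
    rcases hparity i hi with ⟨j, hj, rfl⟩ | ⟨j, hj, rfl⟩
    · have h0 := hgaind (fun j ↦ a (2 * j + 1)) hA0' j (Finset.mem_range.mpr hj)
      have h0' : (a (2 * j + 1) • (ga j : S.Sel ⧸ N)) = 0 := by
        rw [← AddSubgroupClass.coe_zsmul, h0, ZeroMemClass.coe_zero]
      rw [← humk, ← QuotientAddGroup.mk_zsmul, S.quotient_mk_eq_zero_iff'] at h0'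
      rw [hs_odd]
      simpa using h0'
    · have h0 := hgbind (fun j ↦ a (2 * j + 2)) hB0' j (Finset.mem_range.mpr hj)
      have h0' : (a (2 * j + 2) • (gb j : S.Sel ⧸ N)) = 0 := by
        rw [← AddSubgroupClass.coe_zsmul, h0, ZeroMemClass.coe_zero]
      rw [← hvmk, ← QuotientAddGroup.mk_zsmul, S.quotient_mk_eq_zero_iff'] at h0'
      rw [hs_even]
      simpa using h0'
  have hind : ∀ (b : ℤ) (a : ℕ → ℤ), b • S.x + ∑ i ∈ Finset.Ioc 0 (2 * m), a i • s i = 0 →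
      b • S.x = 0 ∧ ∀ i ∈ Finset.Ioc 0 (2 * m), a i • s i = 0 := by
    intro b a h
    have hsumx : (∑ i ∈ Finset.Ioc 0 (2 * m), a i • s i) ∈ AddSubgroup.zmultiples S.x := by
      have : ∑ i ∈ Finset.Ioc 0 (2 * m), a i • s i = (-b) • S.x := by
        rw [neg_smul, eq_neg_iff_add_eq_zero, add_comm, h]
      rw [this]
      exact AddSubgroup.zsmul_mem _ (AddSubgroup.mem_zmultiples _) _
    have h0 : ∀ i ∈ Finset.Ioc 0 (2 * m), a i • s i = 0 := fun i hi ↦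
      hspure i (a i) (hQind a hsumx i hi)
    refine ⟨?_, h0⟩
    rwa [Finset.sum_eq_zero h0, add_zero] at h
  have hroom : ∀ i ∈ Finset.Ioc 0 (2 * m), S.expo (s i) + S.M₀ ≤ S.M := fun i _ ↦ by
    have := S.expo_le_of_pow_zsmul_eq_zero' (hspure i _ (hkill (s i) (hsel i)))
    omega
  -- ### the telescope: `∑ expo sᵢ ≤ M₀`
  have hsumexpo := S.sum_expo_le_M₀_of_casselsTate_of_torsion P hCTV hCeb hcsupp (2 * m) s hsel hτs hiso hind hroom
  rw [sum_Ioc_two_mul' (fun i ↦ S.expo (s i)) m] at hsumexpo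
  simp only [hs_odd, hs_even] at hsumexpo
  -- ### counting: `#Q = (#La #Lb)² = p^{2 ∑ expo}`
  have hordu : ∀ j, addOrderOf (ga j) = S.p ^ S.expo (u j) := fun j ↦ by
    rw [← addOrderOf_injective La.subtype Subtype.val_injective (ga j), AddSubgroup.coe_subtype,
      ← humk, S.addOrderOf_mk_eq_of_pure' (huS j) (hpu j)]
  have hordv : ∀ j, addOrderOf (gb j) = S.p ^ S.expo (v j) := fun j ↦ by
    rw [← addOrderOf_injective Lb.subtype Subtype.val_injective (gb j), AddSubgroup.coe_subtype,
      ← hvmk, S.addOrderOf_mk_eq_of_pure' (hvS j) (hpv j)]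
  have hcardLa : Nat.card La = S.p ^ ∑ j ∈ Finset.range m, S.expo (u j) := by
    rw [hgacard, Finset.prod_congr rfl fun j _ ↦ hordu j, Finset.prod_pow_eq_pow_sum]
  have hcardLb : Nat.card Lb = S.p ^ ∑ j ∈ Finset.range m, S.expo (v j) := by
    rw [hgbcard, Finset.prod_congr rfl fun j _ ↦ hordv j, Finset.prod_pow_eq_pow_sum]
  rw [S.card_sel_eq', hQcard, hcardLa, hcardLb]
  apply Nat.mul_le_mul_left
  rw [← pow_mul, ← pow_mul, ← pow_add]
  exact Nat.pow_le_pow_right hp.pos (by omega)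

end OrderBound

end VisibleSplitHypothesesM

end KolyvaginDescent

end Literature.NumberTheory.EllipticCurves
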